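import Mathlib.Analysis.Calculus.FDeriv.Pow
import Mathlib.Analysis.Calculus.FDeriv.Add
import Mathlib.Analysis.Calculus.FDeriv.Mul
import Mathlib.Algebra.BigOperators.Ring.Finset
import Literature.Analysis.Calculus.RadiiPolynomial
import HarnessLib

/-!
# Radii polynomials of general degree for a POLYNOMIAL nonlinearity in a Banach algebra

Topic `Literature/Analysis/Calculus` (companion of `RadiiPolynomial.lean`, the sup /
contraction form `existsUnique_zero_of_newtonLike`).  When the zero-finding problem lives in a
Banach ALGEBRA `R` (weighted `ℓ¹` sequence algebras, real-analytic function algebras on a disk,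
…) and the nonlinearity is a polynomial `N(x) = Σ_{k ≤ m} c_k x^k` with coefficients `c_k ∈ R`,
the bound `Z(r) ≥ sup_{b ∈ B̄(x̄,r)} ‖I − A·DF(b)‖` required by the sup form is a POLYNOMIAL in
`r` obtained from the binomial theorem and the Banach-algebra inequality `‖xy‖ ≤ ‖x‖‖y‖`.
This is how the radii polynomials of general degree are built in print:

* [GameiroLessard2010] M. Gameiro, J.-P. Lessard, *Analytic estimates and rigorous continuation
  for equilibria of higher-dimensional PDEs*, J. Differential Equations 249 (2010) 2237–2268,
  §3 (preprint pp. 10–11).  For `f` with a polynomial nonlinearity `Σ_{n=2}^p q_n x^n`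
  (convolution powers) they expand, "by the Binomial Theorem" (eq. (22)),
  `DT(x̄ + b)c = −(1/μ_k) Σ_{n=2}^p n r q_n Σ_{j=0}^{n−1} binom(n−1, j) r^j x̄^{n−1−j} ∗ u^j ∗ v`
  (`b = ru`, `c = rv`, `u, v ∈ B(1)`), and bound it (Lemma 3.4, eq. (24)) by the polynomial
  `Z̃_M := (1/μ̃_M) Σ_{n=2}^p n|q_n| Σ_{j=0}^{n−1} binom(n−1, j) ‖x̄‖^{n−1−j} α̃^{(n)} r^j`,
  "a polynomial in r".  Summing the `j ≥ 1` terms gives `(‖x̄‖ + r)^{n−1} − ‖x̄‖^{n−1}`, the form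
  used below (the `j = 0` term is the linearisation at `x̄`, kept separately as `Z₁`).
* [ArioliKoch2019] G. Arioli, H. Koch, *Non-radial solutions for some semilinear elliptic
  equations on the disk*, Nonlinear Anal. 179 (2019) 294–308, §4 Lemma 4.1 (pp. 9–10): for the
  fixed-point problem `G(u) = (−Δ)⁻¹(w f′(u))` on a Banach algebra `B_ρ` of real-analytic
  functions and `N(h) = G(ū + Ah) − ū + Mh`, bounds `ε ≥ ‖N(0)‖`, `K ≥ ‖DN(h)‖ ∀ h ∈ B_δ(0)`
  with `ε + Kδ < δ` give a solution within `‖A‖δ` of `ū` (contraction mapping principle) — the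
  smoothing-operator-times-polynomial structure `F(x) = x − L(v·x + N(x)) − g` packaged below.
* [HungriaLessardMirelesJames2016] §2.1 p. 1433 (the Banach-algebra inequality
  `‖a ∗ b‖_ν ≤ ‖a‖_ν ‖b‖_ν`) and §3 Prop. 1 (the sup form, = `existsUnique_zero_of_newtonLike`).

## What is formalised (all PROVED)

§1 (any normed ring `R` with `‖1‖ = 1`):
* `norm_pow_sub_pow_le` — **`‖x − u‖ ≤ r ⇒ ‖x^n − u^n‖ ≤ (‖u‖ + r)^n − ‖u‖^n`**;
* `addPowSub_nonneg`, `addPowSub_mono_left`, `addPowSub_mono_right` — the majorant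
  `(a + r)^n − a^n` is `≥ 0` and non-decreasing in the centre norm `a ≥ 0` and in `r ≥ 0`
  (so certified UPPER bounds `‖u‖ ≤ U`, `‖c_k‖ ≤ γ_k` may be substituted: the ENDPOINT RULE);
* `addPowSub_eq_sum`, `addPowSub_eq_sum_succ` — `(a + r)^n − a^n = Σ_{j<n} binom(n, j) a^j r^{n−j}
  = Σ_{i<n} binom(n, i+1) a^{n−1−i} r^{i+1}` (its coefficients as a polynomial in `r`, all `≥ 0`,
  no constant term);
* `norm_derivSym_sub_le` — for `N′(x) := Σ_{k≤m} k • (c_k x^{k−1})`: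
  **`‖N′(x) − N′(u)‖ ≤ Σ_{k≤m} k γ_k ((U + r)^{k−1} − U^{k−1})`** =: `polyZ γ m U r`;
* `polyZ_eq_sum_coeff` — `polyZ γ m U r = Σ_{i<m} polyZcoeff γ m U i · r^{i+1}` with the explicit
  coefficients `polyZcoeff γ m U i = Σ_{k≤m} k γ_k binom(k−1, i+1) U^{k−2−i} ≥ 0`
  (`polyZcoeff_nonneg`) — the coefficient list a producer passes to a general-degree closing
  (`Literature.Computation.Certificates.RadiiPolynomialCertificate.PolynomialCert`, whose `check_mono` /
  `degPoly_mono` is the ENDPOINT RULE these nonnegative coefficients make applicable).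

§2 (commutative normed `ℝ`-algebra `R`): `polyMap c m x = Σ_{k≤m} c_k x^k` has Fréchet
derivative `h ↦ N′(x)·h` (`hasFDerivAt_polyMap`, from Mathlib's `HasFDerivAt.pow`); the map
`semilinMap L v c m g x = x − L(v x + N(x)) − g` has derivative
`semilinDeriv L v c m x = I − L ∘ (h ↦ (v + N′(x)) h)` (`hasFDerivAt_semilinMap`), and
**`‖I − A ∘ semilinDeriv(b)‖ ≤ Z₁ + ‖A‖·‖L‖-bound · polyZ γ m U r` on `B̄(x̄, r)`**
(`norm_id_sub_comp_semilinDeriv_le`) given `‖I − A ∘ semilinDeriv(x̄)‖ ≤ Z₁`.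

§3 (`R` complete): `existsUnique_zero_of_semilin` — the sup form closed with that `Z(r)`:
`Y₀ + Z(r)·r < r ⇒` a unique zero of `semilinMap` in `B̄(x̄, r)` and convergence of the
Newton-like iterates (an INSTANCE of `existsUnique_zero_of_newtonLike`; degree-`m` radii
polynomial `p(r) = Y₀ + (Z₁ − 1) r + (Z(r) − Z₁) r`).

## What is NOT covered

No statement that any particular coefficient space IS such an algebra (the weighted `ℓ¹`
spaces of `…ValidatedNumerics.WeightedSeq` carry the inequality `‖a ⋆ b‖ ≤ C‖a‖‖b‖` as a
theorem about families, not as a `NormedRing` instance — a client identifies its space);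
no bound for `Z₁` or `Y₀` (they are the certificate's finite computations); no float model.

## Provenance

AI-produced formalisation (cell certnum, seat certnum-ode-2, 2026-08-27) of the cited printed
estimates, written as the soundness statement behind the `Z(r)` polynomial of the cell's
semilinear closings (`pub/certnum/ode/F2-ROUTE-A.md` §4 (B-SL): `Z₂(r) = ‖A‖·‖Δ_D⁻¹‖·Σ_{k≥2}
k‖C_k‖[(‖ū‖+r)^{k−1} − ‖ū‖^{k−1}]`, closed by cap.nk `radii.polynomial` = T4 via T1 of
`pub/certnum/ode/RADII-SPEC.md`).
-/

set_option autoImplicit false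

open Metric Set Filter Finset
open scoped Topology BigOperators

noncomputable section

namespace Literature.Analysis.Calculus

namespace PolynomialNonlinearity

/-! ### §1. Power differences and the polynomial majorant in a normed ring -/

section Ring

variable {R : Type*} [NormedRing R]

/-- **Power difference on a ball.** In a normed ring with `‖1‖ = 1`: if `‖x − u‖ ≤ r` then
`‖x^n − u^n‖ ≤ (‖u‖ + r)^n − ‖u‖^n` (induction on `x^{n+1} − u^{n+1} = x(x^n − u^n) + (x − u)u^n`
and `‖xy‖ ≤ ‖x‖‖y‖`; no commutativity needed).  This is the sum of the `j ≥ 1` terms of the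
binomial expansion used for polynomial nonlinearities in the radii-polynomial method.
[cite: GameiroLessard2010, §3 eq. (22)–(24) and Lemma 3.4 (binomial expansion of DT(x̄+b)c, majorant polynomial in r)] -/
theorem norm_pow_sub_pow_le [NormOneClass R] {x u : R} {r : ℝ} (hx : ‖x - u‖ ≤ r) (n : ℕ) :
    ‖x ^ n - u ^ n‖ ≤ (‖u‖ + r) ^ n - ‖u‖ ^ n := by
  have hr : 0 ≤ r := (norm_nonneg _).trans hx
  have hxle : ‖x‖ ≤ ‖u‖ + r := (norm_le_insert' x u).trans (by linarith)
  induction n with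
  | zero => simp
  | succ n ih =>
    have e : x ^ (n + 1) - u ^ (n + 1) = x * (x ^ n - u ^ n) + (x - u) * u ^ n := by
      rw [pow_succ', pow_succ', mul_sub, sub_mul]; abel
    have hun : ‖u ^ n‖ ≤ ‖u‖ ^ n := norm_pow_le u n
    have hdn : 0 ≤ (‖u‖ + r) ^ n - ‖u‖ ^ n :=
      sub_nonneg.2 (pow_le_pow_left₀ (norm_nonneg _) (by linarith) n)
    calc ‖x ^ (n + 1) - u ^ (n + 1)‖ = ‖x * (x ^ n - u ^ n) + (x - u) * u ^ n‖ := by rw [e]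
      _ ≤ ‖x‖ * ‖x ^ n - u ^ n‖ + ‖x - u‖ * ‖u ^ n‖ :=
          norm_add_le_of_le (norm_mul_le _ _) (norm_mul_le _ _)
      _ ≤ (‖u‖ + r) * ((‖u‖ + r) ^ n - ‖u‖ ^ n) + r * ‖u‖ ^ n :=
          add_le_add (mul_le_mul hxle ih (norm_nonneg _) (add_nonneg (norm_nonneg _) hr))
            (mul_le_mul hx hun (norm_nonneg _) hr)
      _ = (‖u‖ + r) ^ (n + 1) - ‖u‖ ^ (n + 1) := by ring

/-- The majorant `(a + r)^n − a^n` is nonnegative for `a, r ≥ 0`.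
[cite: GameiroLessard2010, §3 eq. (24) (the tail bound is a polynomial in r with nonnegative coefficients)] -/
theorem addPowSub_nonneg {a r : ℝ} (ha : 0 ≤ a) (hr : 0 ≤ r) (n : ℕ) :
    0 ≤ (a + r) ^ n - a ^ n :=
  sub_nonneg.2 (pow_le_pow_left₀ ha (by linarith) n)

/-- **Endpoint rule, centre norm:** `(a + r)^n − a^n` is non-decreasing in `a ≥ 0` (for `r ≥ 0`),
so an UPPER bound `‖u‖ ≤ U` may replace `‖u‖` in `norm_pow_sub_pow_le`.
[cite: GameiroLessard2010, §3 eq. (24) (nonnegative coefficients ⇒ monotone in ‖x̄‖)] -/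
theorem addPowSub_mono_left {a a' r : ℝ} (ha : 0 ≤ a) (haa' : a ≤ a') (hr : 0 ≤ r) (n : ℕ) :
    (a + r) ^ n - a ^ n ≤ (a' + r) ^ n - a' ^ n := by
  induction n with
  | zero => simp
  | succ n ih =>
    have ha' : 0 ≤ a' := ha.trans haa'
    have e1 : (a + r) ^ (n + 1) - a ^ (n + 1) = (a + r) * ((a + r) ^ n - a ^ n) + r * a ^ n := by ring
    have e2 : (a' + r) ^ (n + 1) - a' ^ (n + 1)
        = (a' + r) * ((a' + r) ^ n - a' ^ n) + r * a' ^ n := by ring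
    rw [e1, e2]
    exact add_le_add
      (mul_le_mul (by linarith) ih (addPowSub_nonneg ha hr n) (by linarith))
      (mul_le_mul_of_nonneg_left (pow_le_pow_left₀ ha haa' n) hr)

/-- **Endpoint rule, radius:** `(a + r)^n − a^n` is non-decreasing in `r` (for `a ≥ 0`, `0 ≤ r ≤ r'`).
[cite: GameiroLessard2010, §3 eq. (24) (nonnegative coefficients ⇒ monotone in r)] -/
theorem addPowSub_mono_right {a r r' : ℝ} (ha : 0 ≤ a) (hr : 0 ≤ r) (hrr' : r ≤ r') (n : ℕ) :
    (a + r) ^ n - a ^ n ≤ (a + r') ^ n - a ^ n :=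
  sub_le_sub_right (pow_le_pow_left₀ (by linarith) (by linarith) n) _

/-- **The majorant as a polynomial in `r`:** `(a + r)^n − a^n = Σ_{j<n} binom(n, j) a^j r^{n−j}`
(binomial theorem with the `j = n` term removed; every coefficient is `≥ 0` for `a ≥ 0` and there
is no `r^0` term).
[cite: GameiroLessard2010, §3 eq. (22) ("by the Binomial Theorem") and eq. (24)] -/
theorem addPowSub_eq_sum (a r : ℝ) (n : ℕ) :
    (a + r) ^ n - a ^ n = ∑ j ∈ range n, (n.choose j : ℝ) * a ^ j * r ^ (n - j) := by
  rw [add_pow, sum_range_succ, Nat.choose_self, Nat.sub_self, pow_zero, mul_one, Nat.cast_one,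
    mul_one, add_sub_cancel_right]
  exact sum_congr rfl fun j _ => by ring

/-- Upper bound `‖u^n‖·` version used termwise: with `‖u‖ ≤ U` and `‖x − u‖ ≤ r`,
`‖x^n − u^n‖ ≤ (U + r)^n − U^n`.
[cite: GameiroLessard2010, §3 Lemma 3.4 eq. (24) (with ‖x̄‖ replaced by an upper bound)] -/
theorem norm_pow_sub_pow_le_of_le [NormOneClass R] {x u : R} {r U : ℝ} (hx : ‖x - u‖ ≤ r)
    (hU : ‖u‖ ≤ U) (n : ℕ) :
    ‖x ^ n - u ^ n‖ ≤ (U + r) ^ n - U ^ n :=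
  (norm_pow_sub_pow_le hx n).trans
    (addPowSub_mono_left (norm_nonneg _) hU ((norm_nonneg _).trans hx) n)

variable [NormedAlgebra ℝ R]

/-- The "derivative symbol" of the polynomial nonlinearity `N(x) = Σ_{k ≤ m} c_k x^k`:
`N′(x) = Σ_{k ≤ m} k • (c_k x^{k−1})` (an element of `R`; in a commutative algebra `DN(x)h = N′(x)·h`,
`hasFDerivAt_polyMap`).
[cite: GameiroLessard2010, §3 eq. (22) (Df(x̄+b)c = μ_k c + Σ n q_n (x̄+b)^{n−1} ∗ c)] -/
def derivSym (c : ℕ → R) (m : ℕ) (x : R) : R :=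
  ∑ k ∈ range (m + 1), (k : ℝ) • (c k * x ^ (k - 1))

/-- The `Z(r)`-increment of a degree-`m` polynomial nonlinearity with coefficient norm bounds `γ_k`
and centre norm bound `U`: `polyZ γ m U r = Σ_{k ≤ m} k γ_k ((U + r)^{k−1} − U^{k−1})` (the `k = 0, 1`
terms vanish; a polynomial in `r` of degree `m − 1` without constant term).
[cite: GameiroLessard2010, §3 eq. (24) (Z̃_M = (1/μ̃_M) Σ_n n|q_n| Σ_j binom(n−1,j)‖x̄‖^{n−1−j} α̃ r^j)] -/
def polyZ (γ : ℕ → ℝ) (m : ℕ) (U r : ℝ) : ℝ :=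
  ∑ k ∈ range (m + 1), (k : ℝ) * γ k * ((U + r) ^ (k - 1) - U ^ (k - 1))

/-- `polyZ` is nonnegative (for `γ_k, U, r ≥ 0`).
[cite: GameiroLessard2010, §3 eq. (24) (nonnegative coefficients)] -/
theorem polyZ_nonneg {γ : ℕ → ℝ} (hγ : ∀ k, 0 ≤ γ k) (m : ℕ) {U r : ℝ} (hU : 0 ≤ U) (hr : 0 ≤ r) :
    0 ≤ polyZ γ m U r :=
  sum_nonneg fun k _ => mul_nonneg (mul_nonneg (Nat.cast_nonneg k) (hγ k)) (addPowSub_nonneg hU hr _)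

/-- `polyZ` is non-decreasing in `r` (ENDPOINT RULE: a bound valid at `r` uses the lower endpoint of
nothing and the upper endpoint of `r`).
[cite: GameiroLessard2010, §3 eq. (24) (nonnegative coefficients ⇒ monotone in r)] -/
theorem polyZ_mono_right {γ : ℕ → ℝ} (hγ : ∀ k, 0 ≤ γ k) (m : ℕ) {U r r' : ℝ} (hU : 0 ≤ U)
    (hr : 0 ≤ r) (hrr' : r ≤ r') : polyZ γ m U r ≤ polyZ γ m U r' :=
  sum_le_sum fun k _ => mul_le_mul_of_nonneg_left (addPowSub_mono_right hU hr hrr' _)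
    (mul_nonneg (Nat.cast_nonneg k) (hγ k))

/-- Shifted binomial expansion: `(a + r)^n − a^n = Σ_{i<n} binom(n, i+1) a^{n−1−i} r^{i+1}` — the
coefficient of `r^{i+1}` made explicit.
[cite: GameiroLessard2010, §3 eq. (22) ("by the Binomial Theorem") and eq. (24) (coefficients binom(n−1,j)‖x̄‖^{n−1−j} of r^j)] -/
theorem addPowSub_eq_sum_succ (a r : ℝ) (n : ℕ) :
    (a + r) ^ n - a ^ n = ∑ i ∈ range n, ((n.choose (i + 1) : ℝ) * a ^ (n - 1 - i)) * r ^ (i + 1) := by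
  rw [add_comm a r, add_pow, sum_range_succ']
  simp only [pow_zero, Nat.sub_zero, Nat.choose_zero_right, Nat.cast_one, one_mul, mul_one,
    add_sub_cancel_right]
  refine sum_congr rfl fun i _ => ?_
  rw [show n - (i + 1) = n - 1 - i from by omega]
  ring

/-- The coefficient of `r^{i+1}` in `polyZ γ m U r`:
`polyZcoeff γ m U i = Σ_{k ≤ m} k γ_k binom(k−1, i+1) U^{k−2−i}` (terms with `k < i + 2` vanish since the
binomial coefficient does) — the list a producer hands to a general-degree radii-polynomial closing
(cap.nk `radii.polynomial` coefficients `Z_1, …, Z_{m−1}` after the factor `‖A‖‖L‖`).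
[cite: GameiroLessard2010, §3 eq. (24) (Z̃_M = (1/μ̃_M) Σ_n n|q_n| Σ_j binom(n−1,j)‖x̄‖^{n−1−j} α̃ r^j, read coefficientwise)] -/
def polyZcoeff (γ : ℕ → ℝ) (m : ℕ) (U : ℝ) (i : ℕ) : ℝ :=
  ∑ k ∈ range (m + 1), (k : ℝ) * γ k * (((k - 1).choose (i + 1) : ℕ) : ℝ) * U ^ (k - 2 - i)

/-- The coefficients `polyZcoeff` are nonnegative (for `γ_k, U ≥ 0`) — so the closing is monotone in
them (ENDPOINT RULE; `Literature.Computation.Certificates.RadiiPolynomialCertificate.degPoly_mono`).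
[cite: GameiroLessard2010, §3 eq. (24) (nonnegative coefficients)] -/
theorem polyZcoeff_nonneg {γ : ℕ → ℝ} (hγ : ∀ k, 0 ≤ γ k) (m : ℕ) {U : ℝ} (hU : 0 ≤ U) (i : ℕ) :
    0 ≤ polyZcoeff γ m U i :=
  sum_nonneg fun k _ => mul_nonneg (mul_nonneg (mul_nonneg (Nat.cast_nonneg k) (hγ k))
    (Nat.cast_nonneg _)) (pow_nonneg hU _)

/-- **`polyZ` coefficientwise:** `polyZ γ m U r = Σ_{i<m} polyZcoeff γ m U i · r^{i+1}` — a polynomial in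
`r` of degree `≤ m − 1` (for `m ≥ 1`) without constant term whose coefficients are the explicit binomial
sums `polyZcoeff` (exchange of the two finite sums).
[cite: GameiroLessard2010, §3 Lemma 3.4 eq. (24) ("Z̃_M is a polynomial in r")] -/
theorem polyZ_eq_sum_coeff (γ : ℕ → ℝ) (m : ℕ) (U r : ℝ) :
    polyZ γ m U r = ∑ i ∈ range m, polyZcoeff γ m U i * r ^ (i + 1) := by
  unfold polyZ polyZcoeff
  have hk : ∀ k ∈ range (m + 1), (k : ℝ) * γ k * ((U + r) ^ (k - 1) - U ^ (k - 1))
      = ∑ i ∈ range m, ((k : ℝ) * γ k * (((k - 1).choose (i + 1) : ℕ) : ℝ) * U ^ (k - 2 - i))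
          * r ^ (i + 1) := by
    intro k hk
    rw [Finset.mem_range] at hk
    rw [addPowSub_eq_sum_succ, mul_sum]
    have hsub : range (k - 1) ⊆ range m := by
      intro i hi
      simp only [Finset.mem_range] at hi ⊢
      omega
    rw [← sum_subset hsub ?_]
    · refine sum_congr rfl fun i _ => ?_
      rw [show k - 1 - 1 - i = k - 2 - i from by omega]
      ring
    · intro i _ hi'
      rw [Finset.mem_range, not_lt] at hi'
      rw [Nat.choose_eq_zero_of_lt (by omega : k - 1 < i + 1), Nat.cast_zero]
      ring
  rw [sum_congr rfl hk, sum_comm]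
  exact sum_congr rfl fun i _ => by rw [sum_mul]

/-- **The `Z₂`-type majorant of a polynomial nonlinearity** (Banach-algebra inequality + binomial
theorem): if `‖x − u‖ ≤ r`, `‖u‖ ≤ U` and `‖c_k‖ ≤ γ_k` then
`‖N′(x) − N′(u)‖ ≤ Σ_{k ≤ m} k γ_k ((U + r)^{k−1} − U^{k−1}) = polyZ γ m U r`.
[cite: GameiroLessard2010, §3 eq. (22)–(24) and Lemma 3.4 (preprint pp. 10–11)] -/
theorem norm_derivSym_sub_le [NormOneClass R] {x u : R} {r U : ℝ} (hx : ‖x - u‖ ≤ r)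
    (hU : ‖u‖ ≤ U) (c : ℕ → R) (m : ℕ) {γ : ℕ → ℝ} (hγ : ∀ k, ‖c k‖ ≤ γ k) :
    ‖derivSym c m x - derivSym c m u‖ ≤ polyZ γ m U r := by
  unfold derivSym polyZ
  rw [← sum_sub_distrib]
  refine (norm_sum_le _ _).trans (sum_le_sum fun k _ => ?_)
  rw [← smul_sub, ← mul_sub, norm_smul, Real.norm_natCast, mul_assoc]
  refine mul_le_mul_of_nonneg_left ?_ (Nat.cast_nonneg k)
  exact (norm_mul_le _ _).trans
    (mul_le_mul (hγ k) (norm_pow_sub_pow_le_of_le hx hU _) (norm_nonneg _)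
      ((norm_nonneg _).trans (hγ k)))

end Ring

/-! ### §2. The derivative of the polynomial nonlinearity and of `x − L(v x + N(x)) − g`
in a commutative normed algebra -/

section CommRing

variable {R : Type*} [NormedCommRing R] [NormedAlgebra ℝ R]

/-- The polynomial nonlinearity `N(x) = Σ_{k ≤ m} c_k x^k` with coefficients in the algebra.
[cite: GameiroLessard2010, §1 eq. (2) (polynomial nonlinearity Σ q_n x^n, coefficients q_n)] -/
def polyMap (c : ℕ → R) (m : ℕ) (x : R) : R := ∑ k ∈ range (m + 1), c k * x ^ k

/-- **`DN(x)h = N′(x)·h`:** the Fréchet derivative of `polyMap c m` at `x` is multiplication by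
`derivSym c m x = Σ k • c_k x^{k−1}` (termwise `D(x^k)h = k x^{k−1} h`, Mathlib `HasFDerivAt.pow`).
[cite: GameiroLessard2010, §3 eq. (22) (Df(x̄+b)c = μ_k c + Σ_n n q_n (x̄+b)^{n−1} ∗ c)] -/
theorem hasFDerivAt_polyMap (c : ℕ → R) (m : ℕ) (x : R) :
    HasFDerivAt (polyMap c m) (ContinuousLinearMap.mul ℝ R (derivSym c m x)) x := by
  have h : HasFDerivAt (polyMap c m)
      (∑ k ∈ range (m + 1), c k • ((k • x ^ (k - 1)) • ContinuousLinearMap.id ℝ R)) x := by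
    unfold polyMap
    exact HasFDerivAt.fun_sum fun k _ => (hasFDerivAt_pow k).const_mul (c k)
  refine h.congr_fderiv ?_
  ext h'
  simp only [_root_.sum_apply, _root_.smul_apply, ContinuousLinearMap.id_apply,
    ContinuousLinearMap.mul_apply', derivSym, sum_mul]
  refine sum_congr rfl fun k _ => ?_
  rw [← Nat.cast_smul_eq_nsmul ℝ]
  simp only [smul_eq_mul]
  simp only [Algebra.smul_def]
  ring

/-- The semilinear fixed-point map of the radii-polynomial / Arioli–Koch scheme in a Banach algebra:
`F(x) = x − L(v·x + N(x)) − g`, `L` a bounded linear (smoothing) operator, `v` a fixed multiplier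
(linear potential), `N` the polynomial nonlinearity, `g` a datum.
[cite: ArioliKoch2019, §4 eq. (4.1) and Lemma 4.1 (G(u) = (−Δ)⁻¹(w f′(u)); N(h) = G(ū+Ah) − ū + Mh)] -/
def semilinMap (L : R →L[ℝ] R) (v : R) (c : ℕ → R) (m : ℕ) (g x : R) : R :=
  x - L (v * x + polyMap c m x) - g

/-- Its derivative `DF(x) = I − L ∘ (h ↦ (v + N′(x))·h)` — the "linearised potential"
`V_lin = v + Σ k c_k x^{k−1}` as a multiplication operator.
[cite: ArioliKoch2019, §4 Lemma 4.1 (DN(h) on the ball); GameiroLessard2010 §3 eq. (22)] -/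
def semilinDeriv (L : R →L[ℝ] R) (v : R) (c : ℕ → R) (m : ℕ) (x : R) : R →L[ℝ] R :=
  ContinuousLinearMap.id ℝ R - L.comp (ContinuousLinearMap.mul ℝ R (v + derivSym c m x))

/-- `semilinMap` has Fréchet derivative `semilinDeriv` everywhere.
[cite: ArioliKoch2019, §4 Lemma 4.1; GameiroLessard2010 §3 eq. (22)] -/
theorem hasFDerivAt_semilinMap (L : R →L[ℝ] R) (v : R) (c : ℕ → R) (m : ℕ) (g x : R) :
    HasFDerivAt (semilinMap L v c m g) (semilinDeriv L v c m x) x := by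
  have h1 : HasFDerivAt (fun y : R => v * y + polyMap c m y)
      (v • ContinuousLinearMap.id ℝ R + ContinuousLinearMap.mul ℝ R (derivSym c m x)) x :=
    ((hasFDerivAt_id x).const_mul v).add (hasFDerivAt_polyMap c m x)
  have h2 : HasFDerivAt (fun y : R => L (v * y + polyMap c m y))
      (L.comp (v • ContinuousLinearMap.id ℝ R + ContinuousLinearMap.mul ℝ R (derivSym c m x))) x :=
    L.hasFDerivAt.comp x h1
  have h3 := ((hasFDerivAt_id x).sub h2).sub_const g
  refine h3.congr_fderiv ?_
  unfold semilinDeriv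
  congr 2
  ext h'
  simp only [_root_.add_apply, _root_.smul_apply, ContinuousLinearMap.id_apply,
    ContinuousLinearMap.mul_apply', add_mul, smul_eq_mul]

/-- **The sup bound `Z(r)` for a polynomial nonlinearity** (general-degree radii polynomial).
If `‖I − A ∘ DF(x̄)‖ ≤ Z₁`, `‖A‖ ≤ a`, `‖L‖ ≤ ℓ`, `‖x̄‖ ≤ U` and `‖c_k‖ ≤ γ_k`, then for every
`b ∈ B̄(x̄, r)`:
`‖I − A ∘ DF(b)‖ ≤ Z₁ + a·ℓ·Σ_{k ≤ m} k γ_k ((U + r)^{k−1} − U^{k−1})`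
(`DF(b) − DF(x̄) = −L ∘ M_{N′(b) − N′(x̄)}`, `‖M_y‖ ≤ ‖y‖`, and `norm_derivSym_sub_le`).
[cite: GameiroLessard2010, §3 Lemma 3.4 eq. (24) (Z̃_M polynomial in r); ArioliKoch2019 §4 Lemma 4.1 (K ≥ ‖DN(h)‖ on B_δ)] -/
theorem norm_id_sub_comp_semilinDeriv_le [NormOneClass R] {L A : R →L[ℝ] R} {v xbar : R}
    {c : ℕ → R} {m : ℕ} {Z₁ a ℓ U : ℝ} {γ : ℕ → ℝ}
    (hZ₁ : ‖ContinuousLinearMap.id ℝ R - A.comp (semilinDeriv L v c m xbar)‖ ≤ Z₁)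
    (ha : ‖A‖ ≤ a) (hℓ : ‖L‖ ≤ ℓ) (hU : ‖xbar‖ ≤ U) (hγ : ∀ k, ‖c k‖ ≤ γ k)
    {r : ℝ} {b : R} (hb : b ∈ closedBall xbar r) :
    ‖ContinuousLinearMap.id ℝ R - A.comp (semilinDeriv L v c m b)‖ ≤ Z₁ + a * ℓ * polyZ γ m U r := by
  have hbr : ‖b - xbar‖ ≤ r := by rwa [mem_closedBall, dist_eq_norm] at hb
  -- `I − A DF(b) = (I − A DF(x̄)) + A ∘ L ∘ M_{N′(b) − N′(x̄)}`
  have e : ContinuousLinearMap.id ℝ R - A.comp (semilinDeriv L v c m b)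
      = (ContinuousLinearMap.id ℝ R - A.comp (semilinDeriv L v c m xbar))
        + A.comp (L.comp (ContinuousLinearMap.mul ℝ R (derivSym c m b - derivSym c m xbar))) := by
    unfold semilinDeriv
    ext h'
    simp only [_root_.sub_apply, ContinuousLinearMap.id_apply, ContinuousLinearMap.comp_apply,
      ContinuousLinearMap.mul_apply', _root_.add_apply, map_sub, map_add]
    abel
  rw [e]
  refine (norm_add_le _ _).trans (add_le_add hZ₁ ?_)
  have hmul : ‖ContinuousLinearMap.mul ℝ R (derivSym c m b - derivSym c m xbar)‖ ≤ polyZ γ m U r :=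
    (ContinuousLinearMap.opNorm_mul_apply_le ℝ R _).trans (norm_derivSym_sub_le hbr hU c m hγ)
  have hZ0 : 0 ≤ polyZ γ m U r := (norm_nonneg _).trans hmul
  calc ‖A.comp (L.comp (ContinuousLinearMap.mul ℝ R (derivSym c m b - derivSym c m xbar)))‖
      ≤ ‖A‖ * (‖L‖ * ‖ContinuousLinearMap.mul ℝ R (derivSym c m b - derivSym c m xbar)‖) :=
        (ContinuousLinearMap.opNorm_comp_le _ _).trans
          (mul_le_mul_of_nonneg_left (ContinuousLinearMap.opNorm_comp_le _ _) (norm_nonneg _))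
    _ ≤ a * (ℓ * polyZ γ m U r) :=
        mul_le_mul ha (mul_le_mul hℓ hmul (norm_nonneg _) ((norm_nonneg _).trans hℓ))
          (mul_nonneg (norm_nonneg _) (norm_nonneg _)) ((norm_nonneg _).trans ha)
    _ = a * ℓ * polyZ γ m U r := by ring

end CommRing

/-! ### §3. The closing: sup form with the degree-`m` radii polynomial -/

section Closing

variable {R : Type*} [NormedCommRing R] [NormOneClass R] [NormedAlgebra ℝ R] [CompleteSpace R]

/-- **Radii polynomial of general degree for `F(x) = x − L(v x + Σ c_k x^k) − g`** in a commutative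
Banach algebra.  Let `A : R →L R` be injective with `‖A F(x̄)‖ ≤ Y₀`, `‖I − A DF(x̄)‖ ≤ Z₁`,
`‖A‖ ≤ a`, `‖L‖ ≤ ℓ`, `‖x̄‖ ≤ U`, `‖c_k‖ ≤ γ_k`, and put
`Z(r) := Z₁ + a ℓ Σ_{k≤m} k γ_k ((U + r)^{k−1} − U^{k−1})`.  If `Y₀ + Z(r)·r < r` for some `r ≥ 0`
(i.e. the degree-`m` radii polynomial `p(r) = Y₀ + (Z(r) − 1) r` is negative at `r`), then `F` has a
unique zero in `B̄(x̄, r)` and the Newton-like iterates `x − A F(x)` from `x̄` converge to it.  This is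
`existsUnique_zero_of_newtonLike` (the sup form) with its `Z`-hypothesis DISCHARGED by
`norm_id_sub_comp_semilinDeriv_le` — the scheme of Arioli–Koch Lemma 4.1 / Gameiro–Lessard
Cor. 3.6 for one Banach-algebra component.
[cite: ArioliKoch2019, §4 Lemma 4.1 (pp. 9–10); GameiroLessard2010 §3 Cor. 3.6 (preprint p. 11)] -/
theorem existsUnique_zero_of_semilin {L A : R →L[ℝ] R} {v g xbar : R} {c : ℕ → R} {m : ℕ}
    {Y₀ Z₁ a ℓ U r : ℝ} {γ : ℕ → ℝ} (hr : 0 ≤ r) (hA : Function.Injective A)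
    (hY : ‖A (semilinMap L v c m g xbar)‖ ≤ Y₀)
    (hZ₁ : ‖ContinuousLinearMap.id ℝ R - A.comp (semilinDeriv L v c m xbar)‖ ≤ Z₁)
    (ha : ‖A‖ ≤ a) (hℓ : ‖L‖ ≤ ℓ) (hU : ‖xbar‖ ≤ U) (hγ : ∀ k, ‖c k‖ ≤ γ k)
    (h : Y₀ + (Z₁ + a * ℓ * polyZ γ m U r) * r < r) :
    ∃ x ∈ closedBall xbar r, semilinMap L v c m g x = 0 ∧
      (∀ y ∈ closedBall xbar r, semilinMap L v c m g y = 0 → y = x) ∧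
      Tendsto (fun n => (newtonLikeMap A (semilinMap L v c m g))^[n] xbar) atTop (𝓝 x) :=
  existsUnique_zero_of_newtonLike hr hA (fun x _ => hasFDerivAt_semilinMap L v c m g x) hY
    (fun _ hb => norm_id_sub_comp_semilinDeriv_le hZ₁ ha hℓ hU hγ hb) h

end Closing

end PolynomialNonlinearity

end Literature.Analysis.Calculus
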